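import Literature.Geometry.Lorentzian.TeukolskyRadialFlux
import Literature.Geometry.Lorentzian.TeukolskyOutgoingExpansion
import HarnessLib

/-!
# The energy flux `Δ · Im(R̄ R′)` of the scalar (`s = 0`) radial Teukolsky / Carter ODE, II:
# the value `ω` at infinity and the energy identity for the normalised pair
# (Teixeira da Costa 2020, Prop. 2.20; DRSR 2014, §5.3 / §7.2)

Sequel of `TeukolskyRadialFlux.lean` (R. Teixeira da Costa, Commun. Math. Phys. 378 (2020)
705–781 = arXiv:1910.02854 [Costa2019]; M. Dafermos–I. Rodnianski–Y. Shlapentokh-Rothman,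
arXiv:1402.7034 [DafermosRodnianskiShlapentokhrothman2014]). There the conserved flux
`F[R](r) = Δ(r)·Im(conj(R(r))·R′(r))` (`= Q^T[u]/ω`) of a classical solution of the scalar radial
ODE was shown to be constant on `(r₊, ∞)` and equal to `−(ω − mω₊)` for the horizon-normalised
solution of Def. 2.3. Here:

* `Costa2019.radialFlux_eq_of_normalisedInfinity` — for `R_𝓘` normalised at `𝓘⁺`
  (`Kerr.IsNormalisedInfinitySolution M 0 ω R_𝓘`: `R_𝓘 = e^{iωr+2iMω log r} Σ_{k≤N} c_k r^{−k−1}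
  + O(r^{−N−2})` for all `N ≥ 1`, `|c₀| = 1`), `M > 0`, `|a| < M`, `ω ≠ 0`: **`F[R_𝓘] ≡ ω`** on
  `(r₊, ∞)` — the `𝓘⁺` boundary value of TdC Prop. 2.20 (DRSR (5.x): `u′ − iωu = 0` at `r = ∞`).
  Proof: `F` is constant, and `F = (Δ/r²)·Im(ū v)` with `u = r Φ̄ R_𝓘 → c₀`,
  `v = r Φ̄ R_𝓘′ → iω c₀` (`Φ = e^{iωr} r^{2iMω}`, `|Φ| = 1`), `Δ/r² → 1`, so `F = ω|c₀|² = ω`; the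
  derivative asymptotics `R_𝓘′ − P_N′ = O(r^{(−N−2+K)/2})` are
  `Costa2019.outgoing_remainder_bounds_allSpin` (`TeukolskyOutgoingExpansion.lean`), used with an
  order `N > K`;
* `Costa2019.norm_sq_radialWronskian_of_normalised` — for the normalised pair,
  **`|𝔚(R_𝓗, R_𝓘)|² = |𝔚(R̄_𝓗, R_𝓘)|² + 4ω(ω − mω₊)`** at every `r > r₊` (Prop. 2.20 for
  `u = u_𝓗` decomposed at `𝓘⁺` as `a_{𝓘⁺} u_𝓘 + a_{𝓘⁻} ū_𝓘`, using `𝔚(R̄_𝓘, R_𝓘) = 2iω`: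
  `ω²|a_{𝓘⁻}|² − ω²|a_{𝓘⁺}|² = ω(ω − mω₊)`, "superradiant iff `ω(ω − mω₊) < 0`");
* `Costa2019.four_mul_omega_mul_le_norm_sq_radialWronskian` — hence `4ω(ω − mω₊) ≤ |𝔚|²`, a
  quantitative lower bound for NON-superradiant frequencies (degenerating at the threshold).

Auxiliary limits (`t·t^q → 0` for `q < −1`, `t·π_N(t) → c₀`, `t·π_N′(t) → 0`, `Δ/t² → 1`) are
proved here as small lemmas. Everything is proved; theorems only.

## References
* R. Teixeira da Costa, CMP 378 (2020) = arXiv:1910.02854: Def. 2.3 (footnote: the expansion at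
  `𝓘⁺`), §2.4.1, Proposition 2.20, Remark 5.1. [Costa2019]
* M. Dafermos, I. Rodnianski, Y. Shlapentokh-Rothman, arXiv:1402.7034: §5.3 (`u′ − iωu = 0` at
  `r = ∞`), §7.2 (`Q^T[u] = ω Im(u′ū)`). [DafermosRodnianskiShlapentokhrothman2014]
-/

noncomputable section

open Complex Set Filter Topology
open scoped ComplexConjugate

namespace Literature.Geometry.Lorentzian.Kerr

namespace Costa2019

/-! ### The flux of an infinity-normalised solution is `ω` -/

/-- `t · t^{q} → 0` as `t → +∞` when `q < −1`. [folklore] -/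
theorem tendsto_mul_rpow_of_lt_neg_one {q : ℝ} (hq : q < -1) :
    Tendsto (fun t : ℝ => t * t ^ q) atTop (𝓝 0) := by
  refine (tendsto_rpow_neg_atTop (y := -(q + 1)) (by linarith)).congr' ?_
  filter_upwards [eventually_gt_atTop 0] with t ht
  rw [neg_neg, Real.rpow_add_one ht.ne', mul_comm]

/-- `t · t^{q} → 0` in `ℂ` as `t → +∞` when `q < −1`. [folklore] -/
theorem tendsto_ofReal_mul_rpow_of_lt_neg_one {q : ℝ} (hq : q < -1) :
    Tendsto (fun t : ℝ => (t : ℂ) * ((t ^ q : ℝ) : ℂ)) atTop (𝓝 0) := by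
  have h := (tendsto_mul_rpow_of_lt_neg_one hq).ofReal
  rw [Complex.ofReal_zero] at h
  exact h.congr fun t => by simp only [Complex.ofReal_mul]

/-- `s = 0`: `t · π_N(t) = Σ_{k ≤ N} c_k t^{−k} → c₀` as `t → ∞` (`π_N = outgoingSum 0 c N`, the
amplitude partial sum of the expansion of Def. 2.3). [cite: Costa2019, Definition 2.3] -/
theorem tendsto_mul_outgoingSum_zero (c : ℕ → ℂ) (N : ℕ) :
    Tendsto (fun t : ℝ => (t : ℂ) * outgoingSum 0 c N t) atTop (𝓝 (c 0)) := by
  have e : ∀ k : ℕ, (-(2 * (0 : ℝ)) - (k : ℝ) - 1) = -(k : ℝ) - 1 := fun k => by ring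
  simp only [outgoingSum, e, Finset.mul_sum]
  have h0 : Tendsto (fun t : ℝ => (t : ℂ) * (c 0 * ((t ^ (-((0 : ℕ) : ℝ) - 1) : ℝ) : ℂ))) atTop
      (𝓝 (c 0)) := by
    refine tendsto_const_nhds.congr' ?_
    filter_upwards [eventually_gt_atTop 0] with t ht
    have ht' : (t : ℂ) ≠ 0 := by exact_mod_cast ht.ne'
    rw [Nat.cast_zero, neg_zero, zero_sub, Real.rpow_neg_one, Complex.ofReal_inv, mul_left_comm,
      mul_inv_cancel₀ ht', mul_one]
  have h1 : ∀ k ∈ Finset.range N, Tendsto (fun t : ℝ =>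
      (t : ℂ) * (c (k + 1) * ((t ^ (-((k + 1 : ℕ) : ℝ) - 1) : ℝ) : ℂ))) atTop (𝓝 0) := by
    intro k _
    have hq : (-((k + 1 : ℕ) : ℝ) - 1) < -1 := by
      have : (0 : ℝ) ≤ k := Nat.cast_nonneg k
      push_cast; linarith
    have h := (tendsto_ofReal_mul_rpow_of_lt_neg_one hq).const_mul (c (k + 1))
    rw [mul_zero] at h
    exact h.congr fun t => by ring
  have h := (tendsto_finsetSum _ h1).add h0
  simp only [Finset.sum_const_zero, zero_add] at h
  exact h.congr fun t => (Finset.sum_range_succ' _ _).symm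

/-- `s = 0`: `t · π_N′(t) = Σ_{k ≤ N} c_k (−k−1) t^{−k−1} → 0` as `t → ∞`
(`π_N′ = outgoingSumDeriv 0 c N`). [cite: Costa2019, Definition 2.3] -/
theorem tendsto_mul_outgoingSumDeriv_zero (c : ℕ → ℂ) (N : ℕ) :
    Tendsto (fun t : ℝ => (t : ℂ) * outgoingSumDeriv 0 c N t) atTop (𝓝 0) := by
  have e1 : ∀ k : ℕ, (-(2 * (0 : ℝ)) - (k : ℝ) - 1) = -(k : ℝ) - 1 := fun k => by ring
  have e2 : ∀ k : ℕ, (-(2 * (0 : ℝ)) - (k : ℝ) - 2) = -(k : ℝ) - 2 := fun k => by ring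
  simp only [outgoingSumDeriv, e1, e2, Finset.mul_sum]
  have h1 : ∀ k ∈ Finset.range (N + 1), Tendsto (fun t : ℝ =>
      (t : ℂ) * (c k * (((-(k : ℝ) - 1) * t ^ (-(k : ℝ) - 2) : ℝ) : ℂ))) atTop (𝓝 0) := by
    intro k _
    have hq : (-(k : ℝ) - 2) < -1 := by
      have : (0 : ℝ) ≤ k := Nat.cast_nonneg k
      linarith
    have h := (tendsto_ofReal_mul_rpow_of_lt_neg_one hq).const_mul (c k * ((-(k : ℝ) - 1 : ℝ) : ℂ))
    rw [mul_zero] at h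
    refine h.congr fun t => ?_
    push_cast
    ring
  have h := tendsto_finsetSum _ h1
  rwa [Finset.sum_const_zero] at h

/-- `e^{iωt} t^{2iMω}` is unimodular: `Φ · conj Φ = 1` (`Φ = outgoingPhase M ω`). [folklore] -/
theorem outgoingPhase_mul_conj (M ω t : ℝ) :
    outgoingPhase M ω t * conj (outgoingPhase M ω t) = 1 := by
  rw [Complex.mul_conj', norm_outgoingPhase]
  simp

/-- `‖t · conj Φ(t) · z‖ = t ‖z‖` for `t > 0`. [folklore] -/
private theorem norm_ofReal_mul_conj_outgoingPhase_mul (M ω : ℝ) {t : ℝ} (ht : 0 < t) (z : ℂ) :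
    ‖(t : ℂ) * conj (outgoingPhase M ω t) * z‖ = t * ‖z‖ := by
  rw [norm_mul, norm_mul, Complex.norm_conj, norm_outgoingPhase, mul_one, Complex.norm_real,
    Real.norm_eq_abs, abs_of_pos ht]

/-- `Δ(t)/t² → 1` as `t → ∞`. [folklore] -/
theorem tendsto_delta_div_sq (M a : ℝ) :
    Tendsto (fun t : ℝ => delta M a t / t ^ 2) atTop (𝓝 1) := by
  have h := tendsto_inv_atTop_zero (𝕜 := ℝ)
  have h2 : Tendsto (fun t : ℝ => 1 - 2 * M * t⁻¹ + a ^ 2 * (t⁻¹ * t⁻¹)) atTop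
      (𝓝 (1 - 2 * M * 0 + a ^ 2 * (0 * 0))) :=
    (tendsto_const_nhds.sub (h.const_mul _)).add ((h.mul h).const_mul _)
  rw [mul_zero, sub_zero, mul_zero, mul_zero, add_zero] at h2
  refine h2.congr' ?_
  filter_upwards [eventually_gt_atTop 0] with t ht
  rw [delta, eq_div_iff (by positivity)]
  field_simp

/-- **The `𝓘⁺` boundary value of the energy identity** (`s = 0`, `M > 0`, `|a| < M`, `ω ≠ 0`):
for a classical radial solution normalised at `𝓘⁺` as in Def. 2.3
(`R = e^{iωr + 2iMω log r} Σ_{k ≤ N} c_k r^{−k−1} + O(r^{−N−2})`, `|c₀| = 1`),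
`Δ(r)·Im(conj(R(r))·R′(r)) = ω` for every `r > r₊` (DRSR: `u′ − iωu = 0` at `r = ∞`; TdC:
`Q^T[u_{𝓘⁺}](+∞) = ω²`). Proof: the flux is constant (`radialFlux_eq`) and equals
`(Δ/r²)·Im(ū v)` with `u = r Φ̄ R → c₀`, `v = r Φ̄ R′ → iω c₀` (`Φ = e^{iωr} r^{2iMω}`; the
derivative asymptotics are `outgoing_remainder_bounds_allSpin`), whose limit is `ω|c₀|² = ω`.
[cite: Costa2019, Proposition 2.20] -/
theorem radialFlux_eq_of_normalisedInfinity {M a ω m lam : ℝ} (hM : 0 < M) (ha : |a| < M)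
    (hω : ω ≠ 0) {R : ℝ → ℂ} (hsol : IsRadialTeukolskySolution M a 0 ω m lam R)
    (hn : IsNormalisedInfinitySolution M 0 ω R) {r : ℝ} (hr : rPlus M a < r) :
    delta M a r * (conj (R r) * deriv R r).im = ω := by
  obtain ⟨c, hc0, hc⟩ := hn
  obtain ⟨K, -, hK⟩ := outgoing_remainder_bounds_allSpin hM ha hω hsol (c := c) hc
  -- an expansion order `N > K`, so that both remainders are `o(r⁻¹)`
  set N : ℕ := ⌈K⌉₊ + 1 with hN
  have hKN : K < N := by
    rw [hN]; push_cast; linarith [Nat.le_ceil K]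
  have hN1 : 1 ≤ N := by rw [hN]; exact Nat.le_add_left 1 _
  obtain ⟨X, C, -, hX1, hB⟩ := hK N hN1 (by norm_num)
  have e1 : (-(2 * (0 : ℝ)) - (N : ℝ) - 2) = -(N : ℝ) - 2 := by ring
  have e2 : (-(N : ℝ) - 2 + K) / 2 = (K - N - 2) / 2 := by ring
  rw [e1, e2] at hB
  have hΦ : ∀ t, outgoingPhase M ω t * conj (outgoingPhase M ω t) = 1 := outgoingPhase_mul_conj M ω
  -- `u = t Φ̄ R → c₀`
  have hu : Tendsto (fun t : ℝ => (t : ℂ) * conj (outgoingPhase M ω t) * R t) atTop (𝓝 (c 0)) := by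
    have h1 : Tendsto (fun t : ℝ => (t : ℂ) * conj (outgoingPhase M ω t) *
        (R t - outgoingP M 0 ω c N t)) atTop (𝓝 0) := by
      have hq : (-(N : ℝ) - 2) < -1 := by
        have : (1 : ℝ) ≤ N := by exact_mod_cast hN1
        linarith
      have hg := (tendsto_mul_rpow_of_lt_neg_one hq).const_mul C
      rw [mul_zero] at hg
      refine squeeze_zero_norm' ?_ hg
      filter_upwards [eventually_ge_atTop X] with t ht
      have ht0 : 0 < t := by linarith
      rw [norm_ofReal_mul_conj_outgoingPhase_mul M ω ht0]
      calc t * ‖R t - outgoingP M 0 ω c N t‖ ≤ t * (C * t ^ (-(N : ℝ) - 2)) :=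
            mul_le_mul_of_nonneg_left (hB t ht).1 ht0.le
        _ = C * (t * t ^ (-(N : ℝ) - 2)) := by ring
    have h := h1.add (tendsto_mul_outgoingSum_zero c N)
    rw [zero_add] at h
    refine h.congr fun t => ?_
    simp only [outgoingP]
    linear_combination (-(t : ℂ) * outgoingSum 0 c N t) * hΦ t
  -- `v = t Φ̄ R′ → iω c₀`
  have hv : Tendsto (fun t : ℝ => (t : ℂ) * conj (outgoingPhase M ω t) * deriv R t) atTop
      (𝓝 (I * ω * c 0)) := by
    have h1 : Tendsto (fun t : ℝ => (t : ℂ) * conj (outgoingPhase M ω t) *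
        (deriv R t - outgoingPDeriv M 0 ω c N t)) atTop (𝓝 0) := by
      have hq : (K - N - 2) / 2 < -1 := by
        rw [div_lt_iff₀ two_pos]; linarith
      have hg := (tendsto_mul_rpow_of_lt_neg_one hq).const_mul C
      rw [mul_zero] at hg
      refine squeeze_zero_norm' ?_ hg
      filter_upwards [eventually_ge_atTop X] with t ht
      have ht0 : 0 < t := by linarith
      rw [norm_ofReal_mul_conj_outgoingPhase_mul M ω ht0]
      calc t * ‖deriv R t - outgoingPDeriv M 0 ω c N t‖ ≤ t * (C * t ^ ((K - N - 2) / 2)) :=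
            mul_le_mul_of_nonneg_left (hB t ht).2 ht0.le
        _ = C * (t * t ^ ((K - N - 2) / 2)) := by ring
    have hinv : Tendsto (fun t : ℝ => (t : ℂ)⁻¹) atTop (𝓝 0) := by
      have := (tendsto_inv_atTop_zero (𝕜 := ℝ)).ofReal
      simpa using this
    have h2 : Tendsto (fun t : ℝ => (I * ω + 2 * I * M * ω * (t : ℂ)⁻¹) *
        ((t : ℂ) * outgoingSum 0 c N t) + (t : ℂ) * outgoingSumDeriv 0 c N t) atTop
        (𝓝 ((I * ω + 2 * I * M * ω * 0) * c 0 + 0)) :=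
      ((tendsto_const_nhds.add (hinv.const_mul _)).mul (tendsto_mul_outgoingSum_zero c N)).add
        (tendsto_mul_outgoingSumDeriv_zero c N)
    rw [mul_zero, add_zero, add_zero] at h2
    have h := h1.add h2
    rw [zero_add] at h
    refine h.congr fun t => ?_
    simp only [outgoingPDeriv]
    linear_combination (-(t : ℂ) * ((I * ω + 2 * I * M * ω * (t : ℂ)⁻¹) * outgoingSum 0 c N t +
      outgoingSumDeriv 0 c N t)) * hΦ t
  -- the flux equals `(Δ/t²) Im(ū v) → 1 · Im(c̄₀ · iω c₀) = ω`, and is constant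
  have hlim : Tendsto (fun t : ℝ => delta M a t / t ^ 2 *
      (conj ((t : ℂ) * conj (outgoingPhase M ω t) * R t) *
        ((t : ℂ) * conj (outgoingPhase M ω t) * deriv R t)).im) atTop
      (𝓝 (1 * (conj (c 0) * (I * ω * c 0)).im)) :=
    (tendsto_delta_div_sq M a).mul ((Complex.continuous_im.tendsto _).comp
      (((Complex.continuous_conj.tendsto _).comp hu).mul hv))
  have hval : 1 * (conj (c 0) * (I * ω * c 0)).im = ω := by
    have e : conj (c 0) * (I * ω * c 0) = I * ω * (conj (c 0) * c 0) := by ring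
    rw [e, Complex.conj_mul', hc0]
    simp
  rw [hval] at hlim
  have hconst : Tendsto (fun t : ℝ => delta M a t / t ^ 2 *
      (conj ((t : ℂ) * conj (outgoingPhase M ω t) * R t) *
        ((t : ℂ) * conj (outgoingPhase M ω t) * deriv R t)).im) atTop
      (𝓝 (delta M a r * (conj (R r) * deriv R r).im)) := by
    refine tendsto_const_nhds.congr' ?_
    filter_upwards [eventually_gt_atTop (rPlus M a), eventually_gt_atTop 0] with t ht ht0
    rw [radialFlux_eq ha.le hsol hr ht]
    have e : conj ((t : ℂ) * conj (outgoingPhase M ω t) * R t) *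
        ((t : ℂ) * conj (outgoingPhase M ω t) * deriv R t) =
        (((t ^ 2 : ℝ)) : ℂ) * (conj (R t) * deriv R t) := by
      simp only [map_mul, Complex.conj_conj, Complex.conj_ofReal]
      push_cast
      linear_combination ((t : ℂ) ^ 2 * conj (R t) * deriv R t) * hΦ t
    rw [e, Complex.im_ofReal_mul]
    field_simp
  exact tendsto_nhds_unique hconst hlim

/-! ### The energy identity for the normalised pair -/

/-- **The energy identity for the normalised pair** (TdC Prop. 2.20 with both boundary values
inserted; `s = 0`, `M > 0`, `|a| < M`, `ω ≠ 0`): for `R_𝓗` normalised at `𝓗⁺` and `R_𝓘`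
normalised at `𝓘⁺`, both classical solutions of the scalar radial ODE, at every `r > r₊`
`|𝔚(R_𝓗, R_𝓘)|² = |𝔚(R̄_𝓗, R_𝓘)|² + 4ω(ω − mω₊)`
(in TdC's notation, `u_𝓗 = a_{𝓘⁺} u_𝓘 + a_{𝓘⁻} ū_𝓘` with `𝔚(R̄_𝓘, R_𝓘) = 2iω`:
`ω²|a_{𝓘⁻}|² = ω²|a_{𝓘⁺}|² + ω(ω − mω₊)`). [cite: Costa2019, Proposition 2.20] -/
theorem norm_sq_radialWronskian_of_normalised {M a ω m lam : ℝ} (hM : 0 < M) (ha : |a| < M)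
    (hω : ω ≠ 0) {RH RI : ℝ → ℂ} (hH : IsRadialTeukolskySolution M a 0 ω m lam RH)
    (hnH : IsNormalisedHorizonSolution M a 0 ω m RH) (hI : IsRadialTeukolskySolution M a 0 ω m lam RI)
    (hnI : IsNormalisedInfinitySolution M 0 ω RI) {r : ℝ} (hr : rPlus M a < r) :
    ‖radialWronskian M a 0 RH RI r‖ ^ 2 =
      ‖radialWronskian M a 0 (fun y => conj (RH y)) RI r‖ ^ 2 +
        4 * ω * (ω - m * horizonAngularVelocity M a) := by
  rw [norm_sq_radialWronskian_of_normalisedHorizon ha hH hnH RI hr,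
    radialFlux_eq_of_normalisedInfinity hM ha hω hI hnI hr]
  ring

/-- **Lower bound on the non-superradiant side**: for the normalised pair as above,
`4ω(ω − mω₊) ≤ |𝔚(R_𝓗, R_𝓘)(r)|²` at every `r > r₊` (informative exactly when `ω(ω − mω₊) > 0`,
i.e. for non-superradiant frequencies; it degenerates at the threshold `ω = mω₊`).
[cite: Costa2019, Proposition 2.20] -/
theorem four_mul_omega_mul_le_norm_sq_radialWronskian {M a ω m lam : ℝ} (hM : 0 < M)
    (ha : |a| < M) (hω : ω ≠ 0) {RH RI : ℝ → ℂ} (hH : IsRadialTeukolskySolution M a 0 ω m lam RH)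
    (hnH : IsNormalisedHorizonSolution M a 0 ω m RH) (hI : IsRadialTeukolskySolution M a 0 ω m lam RI)
    (hnI : IsNormalisedInfinitySolution M 0 ω RI) {r : ℝ} (hr : rPlus M a < r) :
    4 * ω * (ω - m * horizonAngularVelocity M a) ≤ ‖radialWronskian M a 0 RH RI r‖ ^ 2 := by
  rw [norm_sq_radialWronskian_of_normalised hM ha hω hH hnH hI hnI hr]
  nlinarith [sq_nonneg ‖radialWronskian M a 0 (fun y => conj (RH y)) RI r‖]

end Costa2019

end Literature.Geometry.Lorentzian.Kerr

end
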